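import Mathlib.NumberTheory.Primorial
import Mathlib.Data.Nat.Squarefree
import Mathlib.Data.Nat.Factorization.Basic
import Mathlib.Analysis.SpecialFunctions.Log.Basic
import Mathlib.NumberTheory.Harmonic.Bounds
import Mathlib.Data.Fintype.BigOperators
import Mathlib.Data.Fin.Tuple.Basic
import Mathlib.Logic.Equiv.Fin.Basic
import Mathlib.Data.Int.CardIntervalMod
import Mathlib.Data.Int.ModEq
import Mathlib.Data.Int.GCD
import Mathlib.Algebra.Order.Archimedean.Real.Basic
import Mathlib.Tactic
import HarnessLib

/-!
# Maynard–Tao sieve: the support tuples and their combinatorics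

J. Maynard, *Small gaps between primes*, Ann. of Math. (2) 181 (2015), 383–413 = arXiv:1311.4600,
§5 ("Selberg sieve manipulations"), works with sieve variables `(d_1, …, d_k)`, `(r_1, …, r_k)`
supported on tuples with `∏ rᵢ` squarefree, `< R`, and coprime to `W = ∏_{p ≤ D₀} p`; divisor
tuples `dᵢ ∣ rᵢ`; and the Chinese remainder theorem to count
`#{N ≤ n < 2N : n ≡ v₀ (W), [dᵢ, eᵢ] ∣ n + hᵢ}` (proof of Lemma 5.1).

This file sets up the encoding of these objects used by the tree's proof of Proposition 4.1 and
proves its purely combinatorial facts: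

* a support tuple is a *functional* finset `A ⊆ ℕ × Fin k` of pairs `(p, i)` (the prime `p`
  divides `rᵢ`; functional = each prime carries one index = `∏ rᵢ` squarefree),
  `rᵢ = rad A i = ∏_{(p, i) ∈ A} p`; divisor tuples of `A` are exactly its sub-finsets;
* `tuples k D₀ R` (primes in `(D₀, R]`, every `rᵢ ≤ R`) and `tuplesProd k D₀ R` (moreover
  `∏ rᵢ ≤ R`, the support of `λ`), closed under sub-finsets;
* `rad`/`ofNat` is a bijection between `tuples` and the pairwise coprime `k`-tuples of squarefree
  integers in `[1, R]` with all prime factors `> D₀` (`sum_tuples_eq_sum_coprimeTuples`), whence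
  the product bound `sum_tuples_prod_le` (a tuple sum of `∏ᵢ gᵢ(rᵢ)` is at most `∏ᵢ ∑_u gᵢ(u)`);
* `card_prodLeTuples_le`: `#{v ∈ ℕ_{≥1}^K : ∏ vᵢ ≤ X} ≤ X (1 + log X)^{K−1}` (the divisor-sum
  bound behind (5.4), (5.9)) and `sum_tuplesProd_three_pow_le`: `∑_{A ∈ tuplesProd} 3^{|A|}` is at
  most such a count with `K = 3k` (used for `∑_d |λ_d|`);
* the Chinese remainder bookkeeping of the proof of Lemma 5.1: `exists_forall_modEq_iff`
  (congruences modulo `W` and modulo the primes of a tuple are one congruence modulo `W ∏ p`) and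
  `abs_card_filter_modEq_sub_le` (a residue class meets `[a, b)` in `(b − a)/r + O(1)` integers).

## References

* J. Maynard, *Small gaps between primes*, Ann. of Math. (2) 181 (2015), 383–413,
  doi:10.4007/annals.2015.181.1.7 = arXiv:1311.4600; §5, proof of Lemma 5.1, (5.1)–(5.4), (5.9).
  [cite: MaynardAnnals2015]
-/

open Finset Real

namespace Literature.NumberTheory.Sieve
namespace MaynardTao

variable {k : ℕ}

/-! ### Functional finsets of pairs -/

/-- The primes in `(a, b]`. [folklore] -/
def primesIoc (a b : ℕ) : Finset ℕ := (Finset.Ioc a b).filter Nat.Prime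

/-- Membership in `primesIoc`. [folklore] -/
theorem mem_primesIoc {a b p : ℕ} : p ∈ primesIoc a b ↔ (a < p ∧ p ≤ b) ∧ p.Prime := by
  simp [primesIoc]

/-- A finset of (prime, index) pairs is *functional* if each prime carries at most one index:
it then encodes the `k`-tuple `(r_i)` of pairwise coprime squarefree numbers
`r_i = ∏_{(p, i) ∈ A} p` (Maynard 2015, §5: "the condition `μ(d)² = 1` implies that
`(d_i, d_j) = 1` for all `i ≠ j`"). [cite: MaynardAnnals2015, §5 (support of λ)] -/
def IsFunctional (A : Finset (ℕ × Fin k)) : Prop :=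
  ∀ x ∈ A, ∀ y ∈ A, x.1 = y.1 → x = y

/-- Decidability of functionality. [folklore] -/
instance (A : Finset (ℕ × Fin k)) : Decidable (IsFunctional A) := by
  unfold IsFunctional; infer_instance

/-- Sub-finsets of functional finsets are functional. [folklore] -/
theorem IsFunctional.subset {A B : Finset (ℕ × Fin k)} (hA : IsFunctional A) (h : B ⊆ A) :
    IsFunctional B :=
  fun x hx y hy hxy => hA x (h hx) y (h hy) hxy

/-- `Prod.fst` is injective on a functional finset. [folklore] -/
theorem IsFunctional.injOn_fst {A : Finset (ℕ × Fin k)} (hA : IsFunctional A) :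
    Set.InjOn Prod.fst (A : Set (ℕ × Fin k)) :=
  fun x hx y hy hxy => hA x hx y hy hxy

/-- `r_i(A) = ∏_{(p, j) ∈ A, j = i} p`, the `i`-th component of the tuple encoded by `A`.
[cite: MaynardAnnals2015, §5] -/
def rad (A : Finset (ℕ × Fin k)) (i : Fin k) : ℕ := ∏ x ∈ A.filter (fun x => x.2 = i), x.1

/-- `∏_i r_i(A) = ∏_{(p, j) ∈ A} p`. [folklore] -/
theorem prod_rad (A : Finset (ℕ × Fin k)) : ∏ i, rad A i = ∏ x ∈ A, x.1 :=
  Finset.prod_fiberwise A Prod.snd Prod.fst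

/-- `rad ∅ = 1`. [folklore] -/
theorem rad_empty (i : Fin k) : rad (∅ : Finset (ℕ × Fin k)) i = 1 := by simp [rad]

/-- The tuple encoded by a pairwise coprime `k`-tuple of squarefree numbers. [folklore] -/
def ofNat (u : Fin k → ℕ) : Finset (ℕ × Fin k) :=
  Finset.univ.biUnion fun i => (u i).primeFactors ×ˢ {i}

/-- Membership in `ofNat u`. [folklore] -/
theorem mem_ofNat {u : Fin k → ℕ} {x : ℕ × Fin k} : x ∈ ofNat u ↔ x.1 ∈ (u x.2).primeFactors := by
  constructor
  · intro h
    obtain ⟨i, -, hi⟩ := Finset.mem_biUnion.1 h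
    rw [Finset.mem_product, Finset.mem_singleton] at hi
    rw [← hi.2] at hi
    exact hi.1
  · intro h
    exact Finset.mem_biUnion.2 ⟨x.2, Finset.mem_univ _, Finset.mem_product.2 ⟨h, Finset.mem_singleton_self _⟩⟩

/-- `r_i(A)` as a product over the *set* of its primes. [folklore] -/
theorem rad_eq_prod_image {A : Finset (ℕ × Fin k)} (hA : IsFunctional A) (i : Fin k) :
    rad A i = ∏ p ∈ (A.filter (fun x => x.2 = i)).image Prod.fst, p := by
  rw [rad, Finset.prod_image]
  exact fun x hx y hy hxy => hA x (Finset.mem_filter.1 hx).1 y (Finset.mem_filter.1 hy).1 hxy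

/-- For functional `A` consisting of primes, the `i`-th component has exactly the primes of
`A` with index `i`. [folklore] -/
theorem primeFactors_rad {A : Finset (ℕ × Fin k)} (hA : IsFunctional A)
    (hp : ∀ x ∈ A, x.1.Prime) (i : Fin k) :
    (rad A i).primeFactors = (A.filter (fun x => x.2 = i)).image Prod.fst := by
  rw [rad_eq_prod_image hA]
  exact Nat.primeFactors_prod fun p hp' => by
    obtain ⟨x, hx, rfl⟩ := Finset.mem_image.1 hp'
    exact hp x (Finset.mem_filter.1 hx).1

/-- `p ∣ r_i(A)` iff `(p, i) ∈ A`. [folklore] -/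
theorem mem_rad_primeFactors {A : Finset (ℕ × Fin k)} (hA : IsFunctional A)
    (hp : ∀ x ∈ A, x.1.Prime) {i : Fin k} {p : ℕ} :
    p ∈ (rad A i).primeFactors ↔ (p, i) ∈ A := by
  rw [primeFactors_rad hA hp, Finset.mem_image]
  constructor
  · rintro ⟨⟨q, j⟩, hx, rfl⟩
    rw [Finset.mem_filter] at hx
    obtain ⟨hx, rfl⟩ := hx
    exact hx
  · intro h
    exact ⟨(p, i), Finset.mem_filter.2 ⟨h, rfl⟩, rfl⟩

/-- `ofNat ∘ rad = id` on functional finsets of prime pairs. [folklore] -/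
theorem ofNat_rad {A : Finset (ℕ × Fin k)} (hA : IsFunctional A) (hp : ∀ x ∈ A, x.1.Prime) :
    ofNat (rad A) = A := by
  ext ⟨p, i⟩
  rw [mem_ofNat, mem_rad_primeFactors hA hp]

/-- The components of a functional finset of prime pairs are squarefree. [folklore] -/
theorem squarefree_rad {A : Finset (ℕ × Fin k)} (hA : IsFunctional A) (hp : ∀ x ∈ A, x.1.Prime)
    (i : Fin k) : Squarefree (rad A i) := by
  rw [rad_eq_prod_image hA]
  refine Finset.squarefree_prod_of_pairwise_isCoprime ?_ ?_
  · intro p hp' q hq' hpq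
    obtain ⟨x, hx, rfl⟩ := Finset.mem_image.1 hp'
    obtain ⟨y, hy, rfl⟩ := Finset.mem_image.1 hq'
    have hpx := hp x (Finset.mem_filter.1 hx).1
    have hpy := hp y (Finset.mem_filter.1 hy).1
    simp only [Function.onFun]
    rw [← Nat.coprime_iff_isRelPrime]
    exact (Nat.coprime_primes hpx hpy).2 hpq
  · intro p hp'
    obtain ⟨x, hx, rfl⟩ := Finset.mem_image.1 hp'
    exact (hp x (Finset.mem_filter.1 hx).1).squarefree

/-- `r_i(A) > 0`. [folklore] -/
theorem rad_pos {A : Finset (ℕ × Fin k)} (hp : ∀ x ∈ A, x.1.Prime) (i : Fin k) : 0 < rad A i :=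
  Finset.prod_pos fun x hx => (hp x (Finset.mem_filter.1 hx).1).pos

/-- `r_i(A) ≠ 0`. [folklore] -/
theorem rad_ne_zero {A : Finset (ℕ × Fin k)} (hp : ∀ x ∈ A, x.1.Prime) (i : Fin k) :
    rad A i ≠ 0 := (rad_pos hp i).ne'

/-- Distinct components of a functional finset of prime pairs are coprime. [folklore] -/
theorem coprime_rad {A : Finset (ℕ × Fin k)} (hA : IsFunctional A) (hp : ∀ x ∈ A, x.1.Prime)
    {i j : Fin k} (hij : i ≠ j) : (rad A i).Coprime (rad A j) := by
  rw [← Nat.disjoint_primeFactors (rad_ne_zero hp i) (rad_ne_zero hp j), Finset.disjoint_left]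
  intro p hpi hpj
  rw [mem_rad_primeFactors hA hp] at hpi hpj
  exact hij (congrArg Prod.snd (hA _ hpi _ hpj rfl))

/-- `rad` of a sub-finset divides. [folklore] -/
theorem rad_dvd_rad_of_subset {A B : Finset (ℕ × Fin k)} (h : B ⊆ A) (i : Fin k) :
    rad B i ∣ rad A i :=
  Finset.prod_dvd_prod_of_subset _ _ _ (Finset.filter_subset_filter _ h)

/-- `rad (ofNat u) i = u i` for squarefree `u i`. [folklore] -/
theorem rad_ofNat {u : Fin k → ℕ} (hu : ∀ i, Squarefree (u i)) (i : Fin k) : rad (ofNat u) i = u i := by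
  have hfilter : (ofNat u).filter (fun x => x.2 = i) = (u i).primeFactors ×ˢ {i} := by
    ext ⟨p, j⟩
    simp only [Finset.mem_filter, mem_ofNat, Finset.mem_product, Finset.mem_singleton]
    constructor
    · rintro ⟨h, rfl⟩; exact ⟨h, rfl⟩
    · rintro ⟨h, rfl⟩; exact ⟨h, rfl⟩
  rw [rad, hfilter, Finset.prod_product, ]
  simp only [Finset.prod_const, Finset.card_singleton, pow_one]
  exact Nat.prod_primeFactors_of_squarefree (hu i)

/-- `ofNat u` is functional when the `u i` are pairwise coprime. [folklore] -/
theorem isFunctional_ofNat {u : Fin k → ℕ} (hu : ∀ i j, i ≠ j → (u i).Coprime (u j)) :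
    IsFunctional (ofNat u) := by
  rintro ⟨p, i⟩ hx ⟨q, j⟩ hy (rfl : p = q)
  rw [mem_ofNat] at hx hy
  dsimp only at hx hy
  by_contra hne
  have hij : i ≠ j := fun h => hne (by rw [h])
  have hp := Nat.prime_of_mem_primeFactors hx
  have h1 := Nat.dvd_of_mem_primeFactors hx
  have h2 := Nat.dvd_of_mem_primeFactors hy
  exact hp.one_lt.ne' (Nat.eq_one_of_dvd_coprimes (hu i j hij) h1 h2)

/-- Elements of `ofNat u` are prime pairs. [folklore] -/
theorem prime_of_mem_ofNat {u : Fin k → ℕ} {x : ℕ × Fin k} (hx : x ∈ ofNat u) : x.1.Prime :=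
  Nat.prime_of_mem_primeFactors (mem_ofNat.1 hx)

/-! ### The index set of support tuples -/

/-- The support tuples of the sieve: functional finsets of pairs `(p, i)` with `p` a prime in
`(D₀, R]` and every component `r_i ≤ R` (Maynard 2015, §§5–6: tuples `(r_1, …, r_k)` with
`∏ rᵢ` squarefree, coprime to `W = ∏_{p ≤ D₀} p`). [cite: MaynardAnnals2015, §5 (support of y)] -/
def tuples (k D₀ Rn : ℕ) : Finset (Finset (ℕ × Fin k)) :=
  ((primesIoc D₀ Rn) ×ˢ (Finset.univ : Finset (Fin k))).powerset.filter
    (fun A => IsFunctional A ∧ ∀ i, rad A i ≤ Rn)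

variable {D₀ Rn : ℕ}

/-- Membership in `tuples`. [folklore] -/
theorem mem_tuples {A : Finset (ℕ × Fin k)} :
    A ∈ tuples k D₀ Rn ↔
      (∀ x ∈ A, x.1 ∈ primesIoc D₀ Rn) ∧ IsFunctional A ∧ ∀ i, rad A i ≤ Rn := by
  rw [tuples, Finset.mem_filter, Finset.mem_powerset]
  constructor
  · rintro ⟨h1, h2, h3⟩
    exact ⟨fun x hx => (Finset.mem_product.1 (h1 hx)).1, h2, h3⟩
  · rintro ⟨h1, h2, h3⟩
    exact ⟨fun x hx => Finset.mem_product.2 ⟨h1 x hx, Finset.mem_univ _⟩, h2, h3⟩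

/-- Pairs of a support tuple are prime pairs. [folklore] -/
theorem prime_of_mem_tuples {A : Finset (ℕ × Fin k)} (hA : A ∈ tuples k D₀ Rn) {x : ℕ × Fin k}
    (hx : x ∈ A) : x.1.Prime :=
  (mem_primesIoc.1 ((mem_tuples.1 hA).1 x hx)).2

/-- Primes of a support tuple exceed `D₀`. [folklore] -/
theorem lt_of_mem_tuples {A : Finset (ℕ × Fin k)} (hA : A ∈ tuples k D₀ Rn) {x : ℕ × Fin k}
    (hx : x ∈ A) : D₀ < x.1 :=
  (mem_primesIoc.1 ((mem_tuples.1 hA).1 x hx)).1.1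

/-- Support tuples are functional. [folklore] -/
theorem isFunctional_of_mem_tuples {A : Finset (ℕ × Fin k)} (hA : A ∈ tuples k D₀ Rn) :
    IsFunctional A := (mem_tuples.1 hA).2.1

/-- Components of a support tuple are `≤ R`. [folklore] -/
theorem rad_le_of_mem_tuples {A : Finset (ℕ × Fin k)} (hA : A ∈ tuples k D₀ Rn) (i : Fin k) :
    rad A i ≤ Rn := (mem_tuples.1 hA).2.2 i

/-- The index set is closed under passing to sub-finsets (divisor tuples). [folklore] -/
theorem subset_mem_tuples {A B : Finset (ℕ × Fin k)} (hA : A ∈ tuples k D₀ Rn) (h : B ⊆ A) :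
    B ∈ tuples k D₀ Rn := by
  rw [mem_tuples] at hA ⊢
  refine ⟨fun x hx => hA.1 x (h hx), hA.2.1.subset h, fun i => le_trans ?_ (hA.2.2 i)⟩
  exact Nat.le_of_dvd (rad_pos (fun x hx => (mem_primesIoc.1 (hA.1 x hx)).2) i)
    (rad_dvd_rad_of_subset h i)

/-! ### The corresponding integer tuples -/

/-- The admissible values of one component: squarefree `u ∈ [1, R]` all of whose prime factors
exceed `D₀`. [folklore] -/
def goodNat (D₀ Rn : ℕ) : Finset ℕ :=
  (Finset.Icc 1 Rn).filter (fun u => Squarefree u ∧ ∀ p ∈ u.primeFactors, D₀ < p)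

/-- Membership in `goodNat`. [folklore] -/
theorem mem_goodNat {u : ℕ} :
    u ∈ goodNat D₀ Rn ↔ (1 ≤ u ∧ u ≤ Rn) ∧ Squarefree u ∧ ∀ p ∈ u.primeFactors, D₀ < p := by
  simp [goodNat]

/-- Integer `k`-tuples with good components (not necessarily pairwise coprime). [folklore] -/
def goodTuples (k D₀ Rn : ℕ) : Finset (Fin k → ℕ) := Fintype.piFinset fun _ : Fin k => goodNat D₀ Rn

/-- Integer `k`-tuples with good, pairwise coprime components: the image of `tuples` under `rad`.
[folklore] -/
def coprimeTuples (k D₀ Rn : ℕ) : Finset (Fin k → ℕ) :=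
  (goodTuples k D₀ Rn).filter (fun u => ∀ i j, i ≠ j → (u i).Coprime (u j))

/-- `rad` maps support tuples to pairwise coprime good tuples. [folklore] -/
theorem rad_mem_coprimeTuples {A : Finset (ℕ × Fin k)} (hA : A ∈ tuples k D₀ Rn) :
    rad A ∈ coprimeTuples k D₀ Rn := by
  have hp := fun x (hx : x ∈ A) => prime_of_mem_tuples hA hx
  have hf := isFunctional_of_mem_tuples hA
  refine Finset.mem_filter.2 ⟨Fintype.mem_piFinset.2 fun i => mem_goodNat.2 ⟨⟨rad_pos hp i, rad_le_of_mem_tuples hA i⟩, squarefree_rad hf hp i, fun p hpi => ?_⟩, fun i j hij => coprime_rad hf hp hij⟩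
  rw [mem_rad_primeFactors hf hp] at hpi
  exact lt_of_mem_tuples hA hpi

/-- `ofNat` maps pairwise coprime good tuples to support tuples. [folklore] -/
theorem ofNat_mem_tuples {u : Fin k → ℕ} (hu : u ∈ coprimeTuples k D₀ Rn) :
    ofNat u ∈ tuples k D₀ Rn := by
  rw [coprimeTuples, Finset.mem_filter, goodTuples, Fintype.mem_piFinset] at hu
  obtain ⟨hu1, hu2⟩ := hu
  have hu1' := fun i => mem_goodNat.1 (hu1 i)
  have hsq : ∀ i, Squarefree (u i) := fun i => (hu1' i).2.1
  rw [mem_tuples]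
  refine ⟨fun x hx => ?_, isFunctional_ofNat hu2, fun i => ?_⟩
  · have hx' := mem_ofNat.1 hx
    refine mem_primesIoc.2 ⟨⟨(hu1' x.2).2.2 _ hx', ?_⟩, Nat.prime_of_mem_primeFactors hx'⟩
    exact (Nat.le_of_mem_primeFactors hx').trans (hu1' x.2).1.2
  · rw [rad_ofNat hsq]; exact (hu1' i).1.2

/-- `rad ∘ ofNat = id` on pairwise coprime good tuples. [folklore] -/
theorem rad_ofNat_of_mem {u : Fin k → ℕ} (hu : u ∈ coprimeTuples k D₀ Rn) : rad (ofNat u) = u := by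
  rw [coprimeTuples, Finset.mem_filter, goodTuples, Fintype.mem_piFinset] at hu
  exact funext fun i => rad_ofNat (fun i => (mem_goodNat.1 (hu.1 i)).2.1) i

/-- `ofNat ∘ rad = id` on support tuples. [folklore] -/
theorem ofNat_rad_of_mem {A : Finset (ℕ × Fin k)} (hA : A ∈ tuples k D₀ Rn) : ofNat (rad A) = A :=
  ofNat_rad (isFunctional_of_mem_tuples hA) fun _ hx => prime_of_mem_tuples hA hx

/-- **Reindexing**: sums over support tuples are sums over pairwise coprime good integer tuples.
[folklore] -/
theorem sum_tuples_eq_sum_coprimeTuples (Φ : (Fin k → ℕ) → ℝ) :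
    ∑ A ∈ tuples k D₀ Rn, Φ (rad A) = ∑ u ∈ coprimeTuples k D₀ Rn, Φ u :=
  Finset.sum_nbij' rad ofNat (fun _ hA => rad_mem_coprimeTuples hA) (fun _ hu => ofNat_mem_tuples hu)
    (fun _ hA => ofNat_rad_of_mem hA) (fun _ hu => rad_ofNat_of_mem hu) fun _ _ => rfl

/-- **Product bound**: a sum over support tuples of a product of nonnegative one-variable
weights is at most the product of the full one-variable sums (dropping pairwise coprimality).
[folklore] -/
theorem sum_tuples_prod_le (g : Fin k → ℕ → ℝ) (hg : ∀ i, ∀ u ∈ goodNat D₀ Rn, 0 ≤ g i u) :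
    ∑ A ∈ tuples k D₀ Rn, ∏ i, g i (rad A i) ≤ ∏ i, ∑ u ∈ goodNat D₀ Rn, g i u := by
  rw [sum_tuples_eq_sum_coprimeTuples (fun u => ∏ i, g i (u i)), Finset.prod_univ_sum]
  refine Finset.sum_le_sum_of_subset_of_nonneg (Finset.filter_subset _ _) fun u hu _ => ?_
  exact Finset.prod_nonneg fun i _ => hg i (u i) (Fintype.mem_piFinset.1 hu i)

/-! ### Support tuples with bounded product -/

/-- The support tuples with `∏ᵢ rᵢ ≤ R` (the support of Maynard's `y_{r_1,…,r_k}` and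
`λ_{d_1,…,d_k}`: "`∏ d_i < R`", §5). [cite: MaynardAnnals2015, §5 (support of λ)] -/
def tuplesProd (k D₀ Rn : ℕ) : Finset (Finset (ℕ × Fin k)) :=
  (tuples k D₀ Rn).filter (fun A => ∏ x ∈ A, x.1 ≤ Rn)

/-- Membership in `tuplesProd`. [folklore] -/
theorem mem_tuplesProd {A : Finset (ℕ × Fin k)} :
    A ∈ tuplesProd k D₀ Rn ↔ A ∈ tuples k D₀ Rn ∧ ∏ x ∈ A, x.1 ≤ Rn := Finset.mem_filter

/-- `tuplesProd ⊆ tuples`. [folklore] -/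
theorem tuplesProd_subset : tuplesProd k D₀ Rn ⊆ tuples k D₀ Rn := Finset.filter_subset _ _

/-- Membership in `tuplesProd` from the product bound alone. [folklore] -/
theorem mem_tuplesProd_iff {A : Finset (ℕ × Fin k)} :
    A ∈ tuplesProd k D₀ Rn ↔
      (∀ x ∈ A, x.1 ∈ primesIoc D₀ Rn) ∧ IsFunctional A ∧ ∏ x ∈ A, x.1 ≤ Rn := by
  rw [mem_tuplesProd, mem_tuples]
  constructor
  · rintro ⟨⟨h1, h2, -⟩, h3⟩; exact ⟨h1, h2, h3⟩
  · rintro ⟨h1, h2, h3⟩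
    refine ⟨⟨h1, h2, fun i => le_trans ?_ h3⟩, h3⟩
    rw [← prod_rad]
    have hp : ∀ x ∈ A, x.1.Prime := fun x hx => (mem_primesIoc.1 (h1 x hx)).2
    exact Nat.le_of_dvd (Finset.prod_pos fun j _ => rad_pos hp j) (Finset.dvd_prod_of_mem _ (Finset.mem_univ i))

/-- `tuplesProd` is closed under sub-finsets. [folklore] -/
theorem subset_mem_tuplesProd {A B : Finset (ℕ × Fin k)} (hA : A ∈ tuplesProd k D₀ Rn) (h : B ⊆ A) :
    B ∈ tuplesProd k D₀ Rn := by
  rw [mem_tuplesProd] at hA ⊢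
  refine ⟨subset_mem_tuples hA.1 h, le_trans ?_ hA.2⟩
  exact Nat.le_of_dvd (Finset.prod_pos fun x hx => (prime_of_mem_tuples hA.1 hx).pos)
    (Finset.prod_dvd_prod_of_subset _ _ _ h)

/-! ### Counting tuples with bounded product -/

/-- The `K`-tuples of positive integers with product at most `X` (as a finset). [folklore] -/
def prodLeTuples (K X : ℕ) : Finset (Fin K → ℕ) :=
  (Fintype.piFinset fun _ : Fin K => Finset.Icc 1 X).filter (fun v => ∏ i, v i ≤ X)

/-- Membership in `prodLeTuples`. [folklore] -/
theorem mem_prodLeTuples {K X : ℕ} {v : Fin K → ℕ} :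
    v ∈ prodLeTuples K X ↔ (∀ i, 1 ≤ v i ∧ v i ≤ X) ∧ ∏ i, v i ≤ X := by
  simp [prodLeTuples, Fintype.mem_piFinset]

/-- A tuple of positive integers with product `≤ X` has all entries `≤ X`. [folklore] -/
theorem le_of_prod_le {K X : ℕ} {v : Fin K → ℕ} (h1 : ∀ i, 1 ≤ v i) (h : ∏ i, v i ≤ X) (i : Fin K) :
    v i ≤ X :=
  le_trans (Finset.single_le_prod' (fun j _ => h1 j) (Finset.mem_univ i)) h

/-- Sufficient condition for membership in `prodLeTuples`. [folklore] -/
theorem mem_prodLeTuples_of {K X : ℕ} {v : Fin K → ℕ} (h1 : ∀ i, 1 ≤ v i) (h : ∏ i, v i ≤ X) :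
    v ∈ prodLeTuples K X :=
  mem_prodLeTuples.2 ⟨fun i => ⟨h1 i, le_of_prod_le h1 h i⟩, h⟩

/-- The real harmonic sum bound `∑_{v ≤ X} 1/v ≤ 1 + log X`. [folklore] -/
theorem sum_Icc_inv_le_one_add_log (X : ℕ) : ∑ v ∈ Icc 1 X, (1:ℝ) / v ≤ 1 + Real.log X := by
  rcases Nat.eq_zero_or_pos X with rfl | hX
  · simp
  have := harmonic_le_one_add_log X
  rw [harmonic_eq_sum_Icc] at this
  push_cast at this
  simpa only [one_div] using this

/-- **Tuples with bounded product**: `#{v ∈ ℕ_{≥1}^K : ∏ vᵢ ≤ X} ≤ X (1 + log X)^{K-1}` for `K ≥ 1`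
(the bound `∑_{n < R} τ_k(n) ≪ R (log R)^{k-1}` behind Maynard's (5.4), (5.9)).
[cite: MaynardAnnals2015, proof of Lemma 5.1, (5.4)] -/
theorem card_prodLeTuples_le (K : ℕ) (hK : 1 ≤ K) (X : ℕ) :
    ((prodLeTuples K X).card : ℝ) ≤ X * (1 + Real.log X) ^ (K - 1) := by
  induction K, hK using Nat.le_induction generalizing X with
  | base =>
    -- `K = 1`: the tuples are the `v ≤ X`
    simp only [Nat.sub_self, pow_zero, mul_one]
    have : prodLeTuples 1 X ⊆ Fintype.piFinset fun _ : Fin 1 => Finset.Icc 1 X := Finset.filter_subset _ _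
    calc ((prodLeTuples 1 X).card : ℝ) ≤ (Fintype.piFinset fun _ : Fin 1 => Finset.Icc 1 X).card := by
          exact_mod_cast Finset.card_le_card this
      _ = X := by simp [Fintype.card_piFinset]
  | succ K hK ih =>
    -- split off the first coordinate
    have hlog : 0 ≤ Real.log X := Real.log_natCast_nonneg X
    have hmap : ∀ v ∈ prodLeTuples (K + 1) X,
        (⟨v 0, Fin.tail v⟩ : Σ _ : ℕ, Fin K → ℕ) ∈ (Finset.Icc 1 X).sigma fun a => prodLeTuples K (X / a) := by
      intro v hv
      rw [mem_prodLeTuples] at hv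
      obtain ⟨h1, hprod⟩ := hv
      rw [Finset.mem_sigma]
      refine ⟨Finset.mem_Icc.2 (h1 0), mem_prodLeTuples_of (fun i => (h1 i.succ).1) ?_⟩
      rw [Nat.le_div_iff_mul_le (h1 0).1]
      rw [Fin.prod_univ_succ, mul_comm] at hprod
      exact hprod
    have hinj : Set.InjOn (fun v : Fin (K + 1) → ℕ => (⟨v 0, Fin.tail v⟩ : Σ _ : ℕ, Fin K → ℕ))
        (prodLeTuples (K + 1) X : Set (Fin (K + 1) → ℕ)) := by
      intro v _ w _ hvw
      simp only [Sigma.mk.injEq, heq_eq_eq] at hvw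
      rw [← Fin.cons_self_tail v, ← Fin.cons_self_tail w, hvw.1, hvw.2]
    calc ((prodLeTuples (K + 1) X).card : ℝ)
        ≤ (((Finset.Icc 1 X).sigma fun a => prodLeTuples K (X / a)).card : ℝ) := by
          exact_mod_cast Finset.card_le_card_of_injOn _ hmap hinj
      _ = ∑ a ∈ Finset.Icc 1 X, ((prodLeTuples K (X / a)).card : ℝ) := by
          rw [Finset.card_sigma]; push_cast; rfl
      _ ≤ ∑ a ∈ Finset.Icc 1 X, ((X / a : ℕ) : ℝ) * (1 + Real.log ((X / a : ℕ) : ℝ)) ^ (K - 1) :=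
          Finset.sum_le_sum fun a _ => ih (X / a)
      _ ≤ ∑ a ∈ Finset.Icc 1 X, ((X : ℝ) / a) * (1 + Real.log X) ^ (K - 1) := by
          refine Finset.sum_le_sum fun a ha => ?_
          have ha1 : (1 : ℝ) ≤ a := by exact_mod_cast (Finset.mem_Icc.1 ha).1
          have hdiv : ((X / a : ℕ) : ℝ) ≤ (X : ℝ) / a := Nat.cast_div_le
          have hle : ((X / a : ℕ) : ℝ) ≤ X := by exact_mod_cast Nat.div_le_self X a
          have hlog' : Real.log ((X / a : ℕ) : ℝ) ≤ Real.log X := by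
            rcases Nat.eq_zero_or_pos (X / a) with h0 | hpos
            · rw [h0, Nat.cast_zero, Real.log_zero]; exact hlog
            · exact Real.log_le_log (by exact_mod_cast hpos) hle
          have h0 : 0 ≤ Real.log ((X / a : ℕ) : ℝ) := Real.log_natCast_nonneg _
          gcongr
      _ = X * (1 + Real.log X) ^ (K - 1) * ∑ a ∈ Finset.Icc 1 X, (1:ℝ) / a := by
          rw [Finset.mul_sum]
          exact Finset.sum_congr rfl fun a _ => by ring
      _ ≤ X * (1 + Real.log X) ^ (K - 1) * (1 + Real.log X) := by
          gcongr
          exact sum_Icc_inv_le_one_add_log X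
      _ = X * (1 + Real.log X) ^ (K + 1 - 1) := by
          rw [show K + 1 - 1 = (K - 1) + 1 by omega, pow_succ]; ring

/-! ### `∑_{A} 3^{|A|}` is a count of `3k`-tuples with bounded product -/

/-- `∑_{B ⊆ A} 2^{|B|} = 3^{|A|}`. [folklore] -/
theorem sum_powerset_two_pow (A : Finset (ℕ × Fin k)) :
    ∑ B ∈ A.powerset, (2:ℝ) ^ B.card = 3 ^ A.card := by
  have := Finset.sum_pow_mul_eq_add_pow (2:ℝ) 1 A
  simp only [one_pow, mul_one] at this
  rw [this]; norm_num

/-- The three pieces `S`, `B ∖ S`, `A ∖ B` of a triple `S ⊆ B ⊆ A`, as a `3k`-tuple of integers.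
[folklore] -/
def tripleToNat (t : Σ _ : Finset (ℕ × Fin k), Σ _ : Finset (ℕ × Fin k), Finset (ℕ × Fin k)) :
    Fin (3 * k) → ℕ :=
  fun l => match (finProdFinEquiv.symm l).1 with
    | 0 => rad t.2.2 (finProdFinEquiv.symm l).2
    | 1 => rad (t.2.1 \ t.2.2) (finProdFinEquiv.symm l).2
    | 2 => rad (t.1 \ t.2.1) (finProdFinEquiv.symm l).2

/-- The triples `S ⊆ B ⊆ A`, `A ∈ tuplesProd`. [folklore] -/
def triples (k D₀ Rn : ℕ) :
    Finset (Σ _ : Finset (ℕ × Fin k), Σ _ : Finset (ℕ × Fin k), Finset (ℕ × Fin k)) :=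
  (tuplesProd k D₀ Rn).sigma fun A => A.powerset.sigma fun B => B.powerset

/-- `#triples = ∑_A 3^{|A|}`. [folklore] -/
theorem card_triples :
    ((triples k D₀ Rn).card : ℝ) = ∑ A ∈ tuplesProd k D₀ Rn, (3:ℝ) ^ A.card := by
  rw [triples, Finset.card_sigma]
  push_cast
  refine Finset.sum_congr rfl fun A _ => ?_
  rw [Finset.card_sigma]
  push_cast
  simp only [Finset.card_powerset]
  push_cast
  exact sum_powerset_two_pow A

/-- The product over all `3k` slots of `tripleToNat` is `∏_{x ∈ A} p`. [folklore] -/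
theorem prod_tripleToNat {A B S : Finset (ℕ × Fin k)} (hB : B ⊆ A) (hS : S ⊆ B) :
    ∏ l, tripleToNat ⟨A, B, S⟩ l = ∏ x ∈ A, x.1 := by
  rw [← finProdFinEquiv.prod_comp, Fintype.prod_prod_type]
  simp only [tripleToNat, Equiv.symm_apply_apply]
  rw [Fin.prod_univ_three]
  simp only [prod_rad]
  rw [← Finset.prod_sdiff hB, ← Finset.prod_sdiff hS]
  ring

/-- `tripleToNat` is injective on triples of functional prime-pair finsets. [folklore] -/
theorem tripleToNat_injOn :
    Set.InjOn (tripleToNat (k := k)) (triples k D₀ Rn : Set _) := by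
  rintro ⟨A, B, S⟩ ht ⟨A', B', S'⟩ ht' heq
  simp only [Finset.mem_coe, triples, Finset.mem_sigma, Finset.mem_powerset] at ht ht'
  obtain ⟨hA, hB, hS⟩ := ht
  obtain ⟨hA', hB', hS'⟩ := ht'
  have hAt := (mem_tuplesProd.1 hA).1
  have hAt' := (mem_tuplesProd.1 hA').1
  have hfA := (mem_tuples.1 hAt).2.1
  have hfA' := (mem_tuples.1 hAt').2.1
  have hpA : ∀ x ∈ A, x.1.Prime := fun x hx => prime_of_mem_tuples hAt hx
  have hpA' : ∀ x ∈ A', x.1.Prime := fun x hx => prime_of_mem_tuples hAt' hx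
  -- the three rad-vectors agree
  have e : ∀ (j : Fin 3) (i : Fin k), tripleToNat ⟨A, B, S⟩ (finProdFinEquiv (j, i)) =
      tripleToNat ⟨A', B', S'⟩ (finProdFinEquiv (j, i)) := fun j i => by rw [heq]
  have e0 : rad S = rad S' := funext fun i => by simpa [tripleToNat] using e 0 i
  have e1 : rad (B \ S) = rad (B' \ S') := funext fun i => by simpa [tripleToNat] using e 1 i
  have e2 : rad (A \ B) = rad (A' \ B') := funext fun i => by simpa [tripleToNat] using e 2 i
  -- hence the pieces agree
  have piece : ∀ (P P' : Finset (ℕ × Fin k)), P ⊆ A → P' ⊆ A' → rad P = rad P' → P = P' := by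
    intro P P' hP hP' hr
    rw [← ofNat_rad (hfA.subset hP) (fun x hx => hpA x (hP hx)),
      ← ofNat_rad (hfA'.subset hP') (fun x hx => hpA' x (hP' hx)), hr]
  have hSS : S = S' := piece S S' (hS.trans hB) (hS'.trans hB') e0
  have hBS : B \ S = B' \ S' := piece _ _ (Finset.sdiff_subset.trans hB) (Finset.sdiff_subset.trans hB') e1
  have hAB : A \ B = A' \ B' := piece _ _ Finset.sdiff_subset Finset.sdiff_subset e2
  have hBB : B = B' := by
    rw [← Finset.sdiff_union_of_subset hS, ← Finset.sdiff_union_of_subset hS', hBS, hSS]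
  have hAA : A = A' := by
    rw [← Finset.sdiff_union_of_subset hB, ← Finset.sdiff_union_of_subset hB', hAB, hBB]
  subst hAA; subst hBB; subst hSS; rfl

/-- **`∑_{A ∈ tuplesProd} 3^{|A|} ≤ #{v ∈ ℕ_{≥1}^{3k} : ∏ v ≤ R}`** (the combinatorial core of
`∑_d |λ_d| ≪ y_max R (log R)^{O(k)}`, Maynard 2015 (5.4), (5.9)). [cite: MaynardAnnals2015, proof of Lemma 5.1, (5.4)] -/
theorem sum_tuplesProd_three_pow_le :
    ∑ A ∈ tuplesProd k D₀ Rn, (3:ℝ) ^ A.card ≤ (prodLeTuples (3 * k) Rn).card := by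
  rw [← card_triples]
  have hmaps : ∀ t ∈ triples k D₀ Rn, tripleToNat t ∈ prodLeTuples (3 * k) Rn := by
    rintro ⟨A, B, S⟩ ht
    simp only [triples, Finset.mem_sigma, Finset.mem_powerset] at ht
    obtain ⟨hA, hB, hS⟩ := ht
    have hpA : ∀ x ∈ A, x.1.Prime := fun x hx => prime_of_mem_tuples (mem_tuplesProd.1 hA).1 hx
    refine mem_prodLeTuples_of (fun l => ?_) ?_
    · simp only [tripleToNat]
      split
      · exact rad_pos (fun x hx => hpA x (hB (hS hx))) _
      · exact rad_pos (fun x hx => hpA x (hB (Finset.sdiff_subset hx))) _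
      · exact rad_pos (fun x hx => hpA x (Finset.sdiff_subset hx)) _
    · rw [prod_tripleToNat hB hS]; exact (mem_tuplesProd.1 hA).2
  exact_mod_cast Finset.card_le_card_of_injOn tripleToNat hmaps tripleToNat_injOn

/-! ### Chinese remainder bookkeeping -/

/-- Two congruences to coprime moduli are one congruence (Chinese remainder theorem, existence of
the combined residue). [folklore] -/
theorem exists_modEq_and_modEq_iff {M q : ℤ} (h : M.natAbs.Coprime q.natAbs) (a c : ℤ) :
    ∃ x : ℤ, ∀ n : ℤ, (n ≡ a [ZMOD M] ∧ n ≡ c [ZMOD q]) ↔ n ≡ x [ZMOD M * q] := by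
  -- Bezout: `M s + q t = 1`
  have hg : (Int.gcd M q : ℤ) = 1 := by
    rw [Int.gcd_eq_natAbs]  -- gcd as natAbs gcd
    exact_mod_cast h
  obtain ⟨s, t, hst⟩ : ∃ s t : ℤ, M * s + q * t = 1 :=
    ⟨Int.gcdA M q, Int.gcdB M q, by rw [← Int.gcd_eq_gcd_ab]; exact hg⟩
  refine ⟨a * (q * t) + c * (M * s), fun n => ?_⟩
  have hx1 : a * (q * t) + c * (M * s) ≡ a [ZMOD M] := by
    have : a * (q * t) + c * (M * s) = a + M * (c * s - a * s) := by linear_combination a * hst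
    rw [this]
    exact (Int.modEq_iff_dvd.2 ⟨-(c * s - a * s), by ring⟩)
  have hx2 : a * (q * t) + c * (M * s) ≡ c [ZMOD q] := by
    have : a * (q * t) + c * (M * s) = c + q * (a * t - c * t) := by linear_combination c * hst
    rw [this]
    exact (Int.modEq_iff_dvd.2 ⟨-(a * t - c * t), by ring⟩)
  rw [← Int.modEq_and_modEq_iff_modEq_mul h]
  constructor
  · rintro ⟨h1, h2⟩; exact ⟨h1.trans hx1.symm, h2.trans hx2.symm⟩
  · rintro ⟨h1, h2⟩; exact ⟨h1.trans hx1, h2.trans hx2⟩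

/-- **Combining the congruences of the sieve** (Maynard 2015, proof of Lemma 5.1: "By the Chinese
remainder theorem, the inner sum can be written as a sum over a single residue class modulo
`q = W ∏ [d_i, e_i]`, provided that the integers are pairwise coprime"): for a modulus `W ≥ 1`, a
finite set `U` of primes not dividing `W` and targets `c p`, the conditions `n ≡ v₀ (mod W)`,
`n ≡ c p (mod p)` (`p ∈ U`) single out one residue class modulo `W ∏_{p ∈ U} p`.
[cite: MaynardAnnals2015, proof of Lemma 5.1] -/
theorem exists_forall_modEq_iff (W : ℕ) (U : Finset ℕ) (hU : ∀ p ∈ U, p.Prime)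
    (hUW : ∀ p ∈ U, ¬p ∣ W) (c : ℕ → ℤ) (v₀ : ℤ) :
    ∃ a : ℤ, ∀ n : ℤ, (n ≡ v₀ [ZMOD W] ∧ ∀ p ∈ U, n ≡ c p [ZMOD p]) ↔
      n ≡ a [ZMOD (W * ∏ p ∈ U, p : ℕ)] := by
  classical
  induction U using Finset.induction_on with
  | empty => exact ⟨v₀, fun n => by simp⟩
  | insert q U hq ih =>
    obtain ⟨a', ha'⟩ := ih (fun p hp => hU p (Finset.mem_insert_of_mem hp))
      (fun p hp => hUW p (Finset.mem_insert_of_mem hp))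
    have hqP : q.Prime := hU q (Finset.mem_insert_self q U)
    -- `q` is coprime to `W ∏_{p ∈ U} p`
    have hcop : (W * ∏ p ∈ U, p).Coprime q := by
      refine Nat.Coprime.mul_left ?_ ?_
      · exact (Nat.Coprime.symm ((Nat.Prime.coprime_iff_not_dvd hqP).2 (hUW q (Finset.mem_insert_self q U))))
      · refine Nat.Coprime.prod_left fun p hp => ?_
        have hne : p ≠ q := fun h => hq (h ▸ hp)
        exact (Nat.coprime_primes (hU p (Finset.mem_insert_of_mem hp)) hqP).2 hne
    have hcop' : ((W * ∏ p ∈ U, p : ℕ) : ℤ).natAbs.Coprime ((q : ℕ) : ℤ).natAbs := by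
      simpa only [Int.natAbs_natCast] using hcop
    obtain ⟨x, hx⟩ := exists_modEq_and_modEq_iff hcop' a' (c q)
    refine ⟨x, fun n => ?_⟩
    rw [Finset.prod_insert hq, Finset.forall_mem_insert,
      show W * (q * ∏ p ∈ U, p) = (W * ∏ p ∈ U, p) * q by ring]
    have hx' := hx n
    have ha'' := ha' n
    push_cast at hx' ha'' ⊢
    rw [← hx', ← ha'']
    tauto

/-- **Counting a residue class in an interval**: for `r > 0` and `a ≤ b`, the number of
`n ∈ [a, b)` with `n ≡ v (mod r)` is within `1` of `(b − a)/r`. [folklore] -/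
theorem abs_card_filter_modEq_sub_le (a b v : ℤ) (hab : a ≤ b) {r : ℤ} (hr : 0 < r) :
    |(((Finset.Ico a b).filter (fun n => n ≡ v [ZMOD r])).card : ℝ) - ((b : ℝ) - a) / r| ≤ 1 := by
  have hc := Int.Ico_filter_modEq_card a b hr v
  have hmono : ⌈((a : ℚ) - v) / r⌉ ≤ ⌈((b : ℚ) - v) / r⌉ :=
    Int.ceil_le_ceil (div_le_div_of_nonneg_right (by exact_mod_cast sub_le_sub_right hab v)
      (by exact_mod_cast hr.le))
  rw [max_eq_left (sub_nonneg.2 hmono)] at hc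
  have h1 := Int.le_ceil (((b : ℚ) - v) / r)
  have h2 := Int.ceil_lt_add_one (((b : ℚ) - v) / r)
  have h3 := Int.le_ceil (((a : ℚ) - v) / r)
  have h4 := Int.ceil_lt_add_one (((a : ℚ) - v) / r)
  have hr' : (0 : ℚ) < r := by exact_mod_cast hr
  have key : |((((Finset.Ico a b).filter (fun n => n ≡ v [ZMOD r])).card : ℕ) : ℚ) -
      ((b : ℚ) - a) / r| ≤ 1 := by
    have hcq : ((((Finset.Ico a b).filter (fun n => n ≡ v [ZMOD r])).card : ℕ) : ℚ) =
        ((⌈((b : ℚ) - v) / r⌉ - ⌈((a : ℚ) - v) / r⌉ : ℤ) : ℚ) := by exact_mod_cast hc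
    have e : ((b : ℚ) - a) / r = ((b : ℚ) - v) / r - ((a : ℚ) - v) / r := by field_simp; ring
    rw [hcq, e, abs_le]
    push_cast
    constructor <;> linarith
  exact_mod_cast key

end MaynardTao
end Literature.NumberTheory.Sieve
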